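import Literature.AlgebraicGeometry.AbelianSchemes.AbelianSchemeOverSectionPow
import Mathlib.AlgebraicGeometry.Morphisms.Flat
import Mathlib.FieldTheory.IsAlgClosed.AlgebraicClosure
import HarnessLib

/-!
# Over a field, a level-`n` structure EXHAUSTS the `n`-torsion sections: `{σ ∈ A(k) | σⁿ = 1} ⊆ φ̂((ℤ/n)^{2g})`
# ([MumfordFogartyKirwan1994] Ch. 7 §2 Def. 7.1; [MumfordAV1970] §6 App. 3, §7 Thm. 4)

Topic `Literature/AlgebraicGeometry/AbelianSchemes`, namespace `Literature.AlgebraicGeometry.AbelianSchemes.AbelianSchemeOver`.  THEOREMS ONLY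
(no definition, no named fact, no `instance`, no notation, no `sorry`).  Cell `hodgecm-mathlib` (D-0151), P6 «MOD», line L3 (socket `stub_FROB` →
`stub_ROOF0`, `--supports stmt-HodgeConjecture-24832`, count-neutral): the binder (b2) **`hK'φ : ↑K′ ⊆ Set.range φ̂.section_`** of the «DUAL-Q» engine head
★ `nonempty_dualPair_quotient_idealTorsion_geometric` (LA6-p03 (g0) p849273) and of ★ `hStab_of_level_of_natCard_eq(_geometric)`, discharged over a FIELD
base for every subgroup `K′` of `n`-torsion sections.  HC_CM is proved only modulo the printed citations (2 remaining named inputs hLiu418 24832, h413 24833)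
until rung 0 closes; this file is generic and changes no count.

THE MATHEMATICS.  `A` an abelian scheme over `Spec k` (`k` any field), `φ̂ = (σ₁, …, σ_{2g})` a level-`n` structure ([MumfordFogartyKirwan1994] Def. 7.1: the
images `σᵢ(s̄)` form a basis of the `n`-torsion of every geometric fibre).  A section `σ ∈ A(k)` with `σⁿ = 1` restricts at the geometric point
`s̄ : Spec k̄ → Spec k` to an `n`-torsion point, which is `(σ^a)(s̄) = φ̂(a)(s̄)` for some `a ∈ (ℤ/n)^{2g}` (`basis_surjective`); and restriction of sections of
`A → Spec k` to `s̄` is INJECTIVE (`s̄` is an epimorphism of schemes — flat onto a reduced point), so `σ = φ̂(a)`.  No count, no `(n : k) ≠ 0`, no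
relative dimension is needed.

* `epi_specMap_of_field`, `restrict_injective_of_field'` (both private) — restriction of sections to a field-valued point of `Spec k` is injective (the ★
  `AbelianSchemeQuotientIsoOfKernelRank.restrict_injective_of_field`, re-run import-light);
* **`LevelStructure.mem_range_section_of_pow_eq_one`** — `σ ^ n = 1 → σ ∈ Set.range φ.section_`;
* **`LevelStructure.setOf_pow_eq_one_subset_range_section`**, **`LevelStructure.subgroup_subset_range_section_of_pow_eq_one`** — the (b2) binder shapes
  (`{σ | σ ^ n = 1} ⊆ range φ.section_`; `(∀ σ : K′, (σ : A.Sections) ^ n = 1) → ↑K′ ⊆ range φ.section_`).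

## References
* [MumfordFogartyKirwan1994] D. Mumford, J. Fogarty, F. Kirwan, *Geometric Invariant Theory*, 3rd ed. (1994), Ch. 7 §2 Definition 7.1 (p. 129).
* [MumfordAV1970] D. Mumford, *Abelian Varieties* (1970), §6 Application 3 (p. 64), §7 Thm. 4 (p. 72).
* [GortzWedhorn2020] U. Görtz, T. Wedhorn, *Algebraic Geometry I* (2nd ed., 2020), Section (4.7) (pp. 107–108) (points and base change).
-/

set_option autoImplicit false

noncomputable section

universe u

open CategoryTheory CategoryTheory.Limits AlgebraicGeometry MonoidalCategory CartesianMonoidalCategory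
open scoped MonObj

namespace Literature.AlgebraicGeometry.AbelianSchemes

namespace AbelianSchemeOver

variable {k : Type u} [Field k] (A : AbelianSchemeOver (Spec (.of k)))

/-- A field-valued point `s : Spec Ω → Spec k` is an epimorphism of schemes (flat and surjective onto a point, Mathlib
`Flat.epi_of_flat_of_surjective`). [cite: GortzWedhorn2020, Section (4.7) (pp. 107–108)] -/
private theorem epi_specMap_of_field {Ω : Type u} [Field Ω] (s : Spec (.of Ω) ⟶ Spec (.of k)) : Epi s :=
  haveI : Surjective s := ⟨fun _ => ⟨IsLocalRing.closedPoint Ω, Subsingleton.elim _ _⟩⟩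
  Flat.epi_of_flat_of_surjective s

/-- **Over a field, restriction of sections to a field-valued point is injective**: `σ(s̄) = τ(s̄) ⇒ σ = τ` (`(σ(s̄)).left = s̄ ≫ σ.left` and `s̄` is an
epimorphism).  Import-light re-run of ★ `restrict_injective_of_field`. [cite: MumfordAV1970, §7 Thm. 4 (p. 72)] [cite: GortzWedhorn2020, Section (4.7) (pp. 107–108)] -/
private theorem restrict_injective_of_field' {Ω : Type u} [Field Ω] (s : Spec (.of Ω) ⟶ Spec (.of k)) :
    Function.Injective (A.restrict s) := by
  intro σ τ h
  have hl : s ≫ σ.left = s ≫ τ.left := congrArg CommaMorphism.left h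
  haveI := epi_specMap_of_field (k := k) s
  exact Over.OverMorphism.ext ((cancel_epi s).mp hl)

namespace LevelStructure

variable {A} {g n : ℕ} (φ : LevelStructure g n A)

/-- **An `n`-torsion section over a field is a value of the level structure**: `σ ^ n = 1 → ∃ a, φ̂(a) = σ` — restrict to the geometric point
`Spec k̄ → Spec k`, apply `basis_surjective`, and cancel the restriction (`restrict_injective_of_field'`).
[cite: MumfordFogartyKirwan1994, Ch. 7 §2 Definition 7.1 (p. 129)] [cite: MumfordAV1970, §7 Thm. 4 (p. 72)] -/
theorem mem_range_section_of_pow_eq_one {σ : A.Sections} (hσ : σ ^ n = 1) : σ ∈ Set.range φ.section_ := by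
  let s : Spec (.of (AlgebraicClosure k)) ⟶ Spec (.of k) := Spec.map (CommRingCat.ofHom (algebraMap k (AlgebraicClosure k)))
  have hs : A.restrict s σ ^ n = 1 := by rw [← restrict_pow, hσ, restrict_one]
  obtain ⟨a, ha⟩ := φ.basis_surjective s (A.restrict s σ) hs
  exact ⟨a, A.restrict_injective_of_field' s ha⟩

/-- **`{σ ∈ A(k) | σⁿ = 1} ⊆ φ̂((ℤ/n)^{2g})`.** [cite: MumfordFogartyKirwan1994, Ch. 7 §2 Definition 7.1 (p. 129)] -/
theorem setOf_pow_eq_one_subset_range_section : {σ : A.Sections | σ ^ n = 1} ⊆ Set.range φ.section_ :=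
  fun _ hσ => φ.mem_range_section_of_pow_eq_one hσ

/-- **The (b2) binder `hK'φ`**: every subgroup `K′ ≤ A(k)` of `n`-torsion sections lies in the range of the level structure,
`↑K′ ⊆ Set.range φ̂.section_`. [cite: MumfordFogartyKirwan1994, Ch. 7 §2 Definition 7.1 (p. 129)] -/
theorem subgroup_subset_range_section_of_pow_eq_one (K' : Subgroup A.Sections) (hK' : ∀ σ : K', (σ : A.Sections) ^ n = 1) :
    (K' : Set A.Sections) ⊆ Set.range φ.section_ :=
  fun σ hσ => φ.mem_range_section_of_pow_eq_one (hK' ⟨σ, hσ⟩)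

end LevelStructure

end AbelianSchemeOver

end Literature.AlgebraicGeometry.AbelianSchemes

end
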